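import Literature.Probability.RandomPlanarGeometry.SAWTriangularHammersleyWelsh
import Literature.Probability.RandomPlanarGeometry.HammersleyWelshSharp
import HarnessLib

/-!
# Hammersley–Welsh on the triangular lattice with the printed constant:
# `c_N(𝕋) ≤ μ(𝕋)^{N+1} e^{B√N}` for every `B > π√(4/3)` and `N ≥ N₀(B)`

Topic `Literature/Probability/RandomPlanarGeometry` (continues `SAWTriangularHammersleyWelsh.lean`, whose
constant `K = 15` is elementary). Sources: N. Madras, G. Slade, *The Self-Avoiding Walk* (1993), Theorem 3.1.1,
p. 57 ("For any constant `B > π(2/3)^{1/2}`, there exists an `N₀(B)` … such that `c_N ≤ μ^{N+1} e^{BN^{1/2}}`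
for all `N ≥ N₀`") with its proof pp. 58–61 ((3.1.5) `h_N ≤ P_D(N) b_N`, Theorem 3.1.4 Hardy–Ramanujan,
(3.1.7) "the inequality `x^{1/2} + y^{1/2} ≤ (2x+2y)^{1/2}`", (3.1.8)) — for `ℤ^d`, where every step moves
the height by at most `1`; C. Lindorfer, *A general bridge theorem for self-avoiding walks*, Discrete Math.
343 (2020) 112092, Lemma 3.4 ("`h_n ≤ P_D(dn) Σ_m b_m b̄_{n−m}`", `d` the step bound of the height) and
**Lemma 3.5** ("Let `C > π√(2d/3)`. Then there is an integer `N` such that for all `n ≥ N`,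
`c_n ≤ e^{C√(n+1)} β_max^{n+1}`"). For the triangular lattice with the brick height `X = 2x₀ + x₁` the step
bound is `d = 2`, so the printed constant is `π√(4/3) = 2π/√3`; this file proves exactly that instance, with
the tree's NON-asymptotic sharp code count `#{codes of sum ≤ m} ≤ e^{π√(m/3)}`
(`card_finsetsOfSumLE_le_exp_sharp`) in place of Hardy–Ramanujan asymptotics.

## Contents (namespace `Literature.Probability.RandomPlanarGeometry.SAW`)

* `brickHalfSpaceCount_le_exp_sharp_mul_brickBridgeCount` — `h_n(𝕋) ≤ e^{π√(2n/3)} b_n(𝕋)` (codes of sum `≤ 2n`);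
* `triSawCount_le_sharp_mul_brickBridgeCount` — `c_n(𝕋) ≤ (n+1) e^{π√(4(n+1)/3)} b_{n+1}(𝕋)`;
* `exists_threshold_sharp_tri` — for `B > π√(4/3)`: `(N+1) e^{π√(4(N+1)/3)} ≤ e^{B√N}` for `N ≥ N₀(B)`;
* **`triSawCount_le_pow_mul_exp_sharp` : `∀ B > π√(4/3), ∃ N₀, ∀ N ≥ N₀, c_N(𝕋) ≤ μ(𝕋)^{N+1} e^{B√N}`** —
  Madras–Slade's Theorem 3.1.1 shape on `𝕋` with Lindorfer's constant for step bound `2`.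
-/

noncomputable section

open Finset Filter Topology Asymptotics Literature.Probability.LatticeModels Literature.Probability.Percolation
  Literature.Combinatorics.Enumerative
open scoped BigOperators

namespace Literature.Probability.RandomPlanarGeometry.SAW

/-- **`h_n(𝕋) ≤ e^{π√(2n/3)} b_n(𝕋)`** — Proposition 3.1.5 on `𝕋` with the sharp count of the codes (sum `≤ 2n`,
the brick height moves by at most `2` per step). [cite: Lindorfer2020, Lemma 3.4] -/
theorem brickHalfSpaceCount_le_exp_sharp_mul_brickBridgeCount (n : ℕ) :
    (brickHalfSpaceCount n : ℝ) ≤ Real.exp (Real.pi * Real.sqrt (2 * n / 3)) * brickBridgeCount n := by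
  classical
  have hT : brickHalfSpaceWalks n ⊆ brickSaws n := fun ω hω => (mem_brickHalfSpaceWalks.1 hω).1
  have himg : (brickHalfSpaceWalks n).image (brickUnfold n) ⊆ brickBridges n := by
    intro ξ hξ
    obtain ⟨ω, hω, rfl⟩ := Finset.mem_image.1 hξ
    exact brickUnfold_mem_brickBridges hω
  have h := card_le_card_codes_mul_card_image_brickUnfold hT
  have h' : (brickHalfSpaceCount n : ℝ) ≤
      ((finsetsOfSumLE (2 * n)).card : ℝ) * ((brickHalfSpaceWalks n).image (brickUnfold n)).card := by
    exact_mod_cast h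
  have hc := card_finsetsOfSumLE_le_exp_sharp (2 * n)
  push_cast at hc
  calc (brickHalfSpaceCount n : ℝ)
      ≤ ((finsetsOfSumLE (2 * n)).card : ℝ) * ((brickHalfSpaceWalks n).image (brickUnfold n)).card := h'
    _ ≤ Real.exp (Real.pi * Real.sqrt (2 * n / 3)) * ((brickHalfSpaceWalks n).image (brickUnfold n)).card :=
        mul_le_mul_of_nonneg_right hc (Nat.cast_nonneg _)
    _ ≤ Real.exp (Real.pi * Real.sqrt (2 * n / 3)) * brickBridgeCount n := by
        refine mul_le_mul_of_nonneg_left ?_ (Real.exp_nonneg _)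
        exact_mod_cast Finset.card_le_card himg

/-- **`c_n(𝕋) ≤ (n+1) e^{π√(4(n+1)/3)} b_{n+1}(𝕋)`** — (3.1.7) on `𝕋` with the sharp code count
(`√(2a/3) + √(2b/3) ≤ √(4(a+b)/3)`). [cite: MadrasSlade1993, §3.1, proof of Theorem 3.1.1, eq. (3.1.7), pp. 59–60] -/
theorem triSawCount_le_sharp_mul_brickBridgeCount (n : ℕ) :
    (triSawCount n : ℝ) ≤
      (n + 1) * Real.exp (Real.pi * Real.sqrt (4 * (n + 1) / 3)) * brickBridgeCount (n + 1) := by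
  have h1 : (triSawCount n : ℝ) ≤
      ∑ m ∈ Finset.range (n + 1), (brickHalfSpaceCount (m + 1) : ℝ) * brickHalfSpaceCount (n - m) := by
    exact_mod_cast triSawCount_le_sum_brickHalfSpaceCount n
  refine h1.trans ?_
  have hterm : ∀ m ∈ Finset.range (n + 1),
      (brickHalfSpaceCount (m + 1) : ℝ) * brickHalfSpaceCount (n - m) ≤
        Real.exp (Real.pi * Real.sqrt (4 * (n + 1) / 3)) * brickBridgeCount (n + 1) := by
    intro m hm
    rw [Finset.mem_range] at hm
    have ha := brickHalfSpaceCount_le_exp_sharp_mul_brickBridgeCount (m + 1)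
    have hb := brickHalfSpaceCount_le_exp_sharp_mul_brickBridgeCount (n - m)
    have hsum : Real.sqrt (2 * ((m + 1 : ℕ) : ℝ) / 3) + Real.sqrt (2 * ((n - m : ℕ) : ℝ) / 3) ≤
        Real.sqrt (4 * (n + 1) / 3) := by
      have h := Zd.sqrt_add_sqrt_le_sqrt_two_mul (a := 2 * ((m + 1 : ℕ) : ℝ) / 3)
        (b := 2 * ((n - m : ℕ) : ℝ) / 3) (by positivity) (by positivity)
      refine h.trans (le_of_eq ?_)
      congr 1
      have : ((n - m : ℕ) : ℝ) = n - m := by rw [Nat.cast_sub (by omega)]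
      rw [this]; push_cast; ring
    have hbb : (brickBridgeCount (m + 1) : ℝ) * brickBridgeCount (n - m) ≤ brickBridgeCount (n + 1) := by
      have := brickBridgeCount_mul_le (m + 1) (n - m)
      rw [show m + 1 + (n - m) = n + 1 by omega] at this
      exact_mod_cast this
    calc (brickHalfSpaceCount (m + 1) : ℝ) * brickHalfSpaceCount (n - m)
        ≤ (Real.exp (Real.pi * Real.sqrt (2 * ((m + 1 : ℕ) : ℝ) / 3)) * brickBridgeCount (m + 1)) *
            (Real.exp (Real.pi * Real.sqrt (2 * ((n - m : ℕ) : ℝ) / 3)) * brickBridgeCount (n - m)) :=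
          mul_le_mul ha hb (Nat.cast_nonneg _) (by positivity)
      _ = Real.exp (Real.pi * (Real.sqrt (2 * ((m + 1 : ℕ) : ℝ) / 3) +
            Real.sqrt (2 * ((n - m : ℕ) : ℝ) / 3))) * ((brickBridgeCount (m + 1) : ℝ) * brickBridgeCount (n - m)) := by
          rw [mul_add, Real.exp_add]; ring
      _ ≤ Real.exp (Real.pi * Real.sqrt (4 * (n + 1) / 3)) * brickBridgeCount (n + 1) := by
          refine mul_le_mul ?_ hbb (by positivity) (Real.exp_nonneg _)
          exact Real.exp_le_exp.2 (mul_le_mul_of_nonneg_left hsum Real.pi_pos.le)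
  calc ∑ m ∈ Finset.range (n + 1), (brickHalfSpaceCount (m + 1) : ℝ) * brickHalfSpaceCount (n - m)
      ≤ ∑ _m ∈ Finset.range (n + 1), Real.exp (Real.pi * Real.sqrt (4 * (n + 1) / 3)) * brickBridgeCount (n + 1) :=
        Finset.sum_le_sum hterm
    _ = (n + 1) * Real.exp (Real.pi * Real.sqrt (4 * (n + 1) / 3)) * brickBridgeCount (n + 1) := by
        rw [Finset.sum_const, Finset.card_range, nsmul_eq_mul]; push_cast; ring

/-- The threshold for step bound `2`: for `B > π√(4/3)` there is `N₀ = N₀(B)` with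
`(N+1) e^{π√(4(N+1)/3)} ≤ e^{B√N}` for all `N ≥ N₀` (`log(N+1) = o(√N)`, `√(N+1) ≤ √N + 1`; the tree's
`Zd.exists_threshold_sharp` argument with `π√(2/3)` replaced by `π√(4/3)`).
[cite: MadrasSlade1993, §3.1, proof of Theorem 3.1.1, eq. (3.1.8)] -/
theorem exists_threshold_sharp_tri {B : ℝ} (hB : Real.pi * Real.sqrt (4 / 3) < B) :
    ∃ N₀ : ℕ, ∀ N : ℕ, N₀ ≤ N →
      ((N : ℝ) + 1) * Real.exp (Real.pi * Real.sqrt (4 * (N + 1) / 3)) ≤ Real.exp (B * Real.sqrt N) := by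
  set a : ℝ := Real.pi * Real.sqrt (4 / 3) with ha
  have ha0 : 0 < a := by positivity
  set δ : ℝ := (B - a) / 2 with hδ
  have hδ0 : 0 < δ := by rw [hδ]; linarith
  have hlog : ∀ᶠ x : ℝ in atTop, ‖Real.log x‖ ≤ δ / 2 * ‖x ^ ((1 : ℝ) / 2)‖ :=
    (isLittleO_log_rpow_atTop (by norm_num : (0 : ℝ) < 1 / 2)).bound (by positivity)
  obtain ⟨X, hX⟩ := Filter.eventually_atTop.1 hlog
  refine ⟨max (Nat.ceil X) (Nat.ceil (((δ + 2 * a) / (3 * δ)) ^ 2)), fun N hN => ?_⟩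
  have hN1 : (Nat.ceil X : ℝ) ≤ N := by exact_mod_cast (le_max_left _ _).trans hN
  have hN2 : (Nat.ceil (((δ + 2 * a) / (3 * δ)) ^ 2) : ℝ) ≤ N := by
    exact_mod_cast (le_max_right _ _).trans hN
  have hXN : X ≤ (N : ℝ) + 1 := ((Nat.le_ceil X).trans hN1).trans (by linarith)
  have hsN : (δ + 2 * a) / (3 * δ) ≤ Real.sqrt N := by
    have h1 : ((δ + 2 * a) / (3 * δ)) ^ 2 ≤ (N : ℝ) := (Nat.le_ceil _).trans hN2
    calc (δ + 2 * a) / (3 * δ) = Real.sqrt (((δ + 2 * a) / (3 * δ)) ^ 2) := by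
          rw [Real.sqrt_sq (by positivity)]
      _ ≤ Real.sqrt N := Real.sqrt_le_sqrt h1
  have hs0 : 0 ≤ Real.sqrt (N : ℝ) := Real.sqrt_nonneg _
  have hlogN : Real.log ((N : ℝ) + 1) ≤ δ / 2 * Real.sqrt ((N : ℝ) + 1) := by
    have h := hX _ hXN
    rw [Real.norm_eq_abs, Real.norm_eq_abs, ← Real.sqrt_eq_rpow, abs_of_nonneg (Real.sqrt_nonneg _)] at h
    exact (le_abs_self _).trans h
  have hsucc : Real.sqrt ((N : ℝ) + 1) ≤ Real.sqrt N + 1 := by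
    rw [Real.sqrt_le_left (by positivity)]
    nlinarith [Real.sq_sqrt (Nat.cast_nonneg N), hs0]
  have hsq43 : Real.sqrt (4 * ((N : ℝ) + 1) / 3) = Real.sqrt (4 / 3) * Real.sqrt ((N : ℝ) + 1) := by
    rw [show (4 : ℝ) * ((N : ℝ) + 1) / 3 = (4 / 3) * ((N : ℝ) + 1) by ring,
      Real.sqrt_mul (by norm_num)]
  have hkey : Real.log ((N : ℝ) + 1) + Real.pi * Real.sqrt (4 * ((N : ℝ) + 1) / 3) ≤ B * Real.sqrt N := by
    rw [hsq43, ← mul_assoc, ← ha]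
    have hB' : B = a + 2 * δ := by rw [hδ]; ring
    rw [hB']
    have h3 : a * Real.sqrt ((N : ℝ) + 1) ≤ a * (Real.sqrt N + 1) := mul_le_mul_of_nonneg_left hsucc ha0.le
    have h4 : δ / 2 * Real.sqrt ((N : ℝ) + 1) ≤ δ / 2 * (Real.sqrt N + 1) :=
      mul_le_mul_of_nonneg_left hsucc (by positivity)
    have h5 : δ / 2 + a ≤ 3 * δ / 2 * Real.sqrt N := by
      have := mul_le_mul_of_nonneg_left hsN (show (0 : ℝ) ≤ 3 * δ / 2 by positivity)
      rw [show 3 * δ / 2 * ((δ + 2 * a) / (3 * δ)) = δ / 2 + a by field_simp] at this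
      exact this
    nlinarith
  have hpos : (0 : ℝ) < (N : ℝ) + 1 := by positivity
  calc ((N : ℝ) + 1) * Real.exp (Real.pi * Real.sqrt (4 * (N + 1) / 3))
      = Real.exp (Real.log ((N : ℝ) + 1) + Real.pi * Real.sqrt (4 * ((N : ℝ) + 1) / 3)) := by
        rw [Real.exp_add, Real.exp_log hpos]
    _ ≤ Real.exp (B * Real.sqrt N) := Real.exp_le_exp.2 hkey

/-- **Hammersley–Welsh on `𝕋` with the printed constant** (Madras–Slade Theorem 3.1.1 shape; Lindorfer's
constant `π√(2d/3)` for the brick height function of `𝕋`, step bound `d = 2`): for every `B > π√(4/3)`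
there is `N₀(B)` with `c_N(𝕋) ≤ μ(𝕋)^{N+1} e^{B√N}` for all `N ≥ N₀`. First kernel text for `𝕋`; the
statement is a printed general theorem instantiated. [cite: Lindorfer2020, Lemma 3.5] -/
theorem triSawCount_le_pow_mul_exp_sharp {B : ℝ} (hB : Real.pi * Real.sqrt (4 / 3) < B) :
    ∃ N₀ : ℕ, ∀ N : ℕ, N₀ ≤ N →
      (triSawCount N : ℝ) ≤ Real.exp logMuTri ^ (N + 1) * Real.exp (B * Real.sqrt N) := by
  obtain ⟨N₀, hN₀⟩ := exists_threshold_sharp_tri hB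
  refine ⟨N₀, fun N hN => ?_⟩
  have hμ : (0 : ℝ) < Real.exp logMuTri := Real.exp_pos _
  have h1 := triSawCount_le_sharp_mul_brickBridgeCount N
  have h2 : (brickBridgeCount (N + 1) : ℝ) ≤ Real.exp logMuTri ^ (N + 1) := brickBridgeCount_le_pow (N + 1)
  have h3 := hN₀ N hN
  calc (triSawCount N : ℝ)
      ≤ ((N : ℝ) + 1) * Real.exp (Real.pi * Real.sqrt (4 * (N + 1) / 3)) * brickBridgeCount (N + 1) := h1
    _ ≤ ((N : ℝ) + 1) * Real.exp (Real.pi * Real.sqrt (4 * (N + 1) / 3)) * Real.exp logMuTri ^ (N + 1) := by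
        gcongr
    _ ≤ Real.exp (B * Real.sqrt N) * Real.exp logMuTri ^ (N + 1) :=
        mul_le_mul_of_nonneg_right h3 (pow_nonneg hμ.le _)
    _ = Real.exp logMuTri ^ (N + 1) * Real.exp (B * Real.sqrt N) := mul_comm _ _

end Literature.Probability.RandomPlanarGeometry.SAW
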